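import Mathlib
import Summits.Ventures.PercRepro.TriangleCapRowJTable

/-!
# PercRepro — THE ROWS `r = a + j` WITH `a ≤ j + 4`: THE ARITHMETIC OF THE DELETION READS AGAINST THE ONE-TRIANGLE
TARGET `T = 2k − 14 + 2j (a − 3)` (p3, gen 49; part 203b)

On the cell `(k, a, a + j)` with `a ≤ j + 4` the one-triangle family `tFamilyGen (k − 1) a (j + 2)` is the closer
of the two families: `T = 2k − 14 + 2j (a − 3) ≤ 2 (k − a − 3) + 2j (a − 2)` (the `(j + 1)`-broom) exactly when
`a ≤ j + 4`. A vertex `z` of degree `d ≤ a − 1` deleted onto `(k − 1, a, d + j)` against the target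
`(a + j)(k − 1 − (a + j)) + (2k − 14 + 2j (a − 3))`, `k ≥ 3a + j`:
* `D − z` not `a`-bipartite with the gap of its cell: `rowT_del_B2` (the `B2` regime `d + j ≤ a − 3`, slack
  `≥ 6d + 8j + 4c + 2`), `rowT_del_T` (`d + j = a − 2`, slack `2`), `rowT_del_B` (`d + j = a − 1`, slack `6 − 2d`,
  `d ≤ 3` from `a ≤ j + 4`), `rowT_del_up_broom` (`d + j = a + j′` with `j′ ≤ a − 5`, the `(j′ + 1)`-broom gap of the
  smaller row, slack `2j′ v + 4v − 2u ≥ 2v` with `u ≤ v` from `a ≤ j + 4`), `rowT_del_up_T` (`d + j = a + j′` with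
  `a ≤ j′ + 4`, the one-triangle gap of the smaller row, slack `2uv + 2qv + 6v + 2`); the neighbours of `z` at
  `≤ k − a − 2`;
* the all-off read `rowT_alloff_arith` (`D − z` `a`-bipartite with every neighbour of `z` off the side: the plain
  star bound of `D − z` and the off-side neighbours at `≤ a`; slack `2 (j + 4 − a)` at `d = 1`, EXACT at `a = j + 4`);
* the crude mixed read at `d = 2` (`rowT_mixed_two`, slack `2`).
Every slack is an explicit polynomial with non-negative value on the range (mining/p3/g49 slackT.py); the natural
subtractions are cast to `ℤ` (`zify`) under their side conditions. Axioms: standard.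
-/

namespace PercRepro

namespace TriangleCap

namespace C047

/-- `d + j + 3 ≤ a`: `D − z` on a `B2` cell `(k − 1, a, d + j)`, against the one-triangle target. -/
theorem rowT_del_B2 (a j d k m' S' T : ℕ) (hs : d + j + 3 ≤ a) (hk : 3 * a + j ≤ k)
    (hmd : m' + d + (a + j) = a * (k - a))
    (hgap : S' + (d + j) * (k - 1 - 1 - (d + j)) + 2 * (k - 1 - 2 * a - 1) * (a - (d + j)) ≤ m' * (k - 1))
    (hT : T ≤ d * (k - a - 2)) :
    S' + 2 * T + d + d * d + (a + j) * (k - 1 - (a + j)) + (2 * k - 14 + 2 * j * (a - 3)) ≤ (m' + d) * k := by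
  obtain ⟨u, rfl⟩ : ∃ u, a = d + j + 3 + u := ⟨a - (d + j + 3), by omega⟩
  obtain ⟨c, rfl⟩ : ∃ c, k = 3 * (d + j + 3 + u) + j + c := ⟨k - (3 * (d + j + 3 + u) + j), by omega⟩
  have s1 : 1 ≤ 3 * (d + j + 3 + u) + j + c := by omega
  have s2 : 1 ≤ 3 * (d + j + 3 + u) + j + c - 1 := by omega
  have s3 : d + j ≤ 3 * (d + j + 3 + u) + j + c - 1 - 1 := by omega
  have s4 : 2 * (d + j + 3 + u) ≤ 3 * (d + j + 3 + u) + j + c - 1 := by omega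
  have s5 : 1 ≤ 3 * (d + j + 3 + u) + j + c - 1 - 2 * (d + j + 3 + u) := by omega
  have s6 : d + j ≤ d + j + 3 + u := by omega
  have s7 : d + j + 3 + u ≤ 3 * (d + j + 3 + u) + j + c := by omega
  have s8 : 2 ≤ 3 * (d + j + 3 + u) + j + c - (d + j + 3 + u) := by omega
  have s9 : d + j + 3 + u + j ≤ 3 * (d + j + 3 + u) + j + c - 1 := by omega
  have s10 : 14 ≤ 2 * (3 * (d + j + 3 + u) + j + c) := by omega
  have s11 : 3 ≤ d + j + 3 + u := by omega
  zify [s1, s2, s3, s4, s5, s6, s7, s8, s9, s10, s11] at hgap hT hmd ⊢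
  nlinarith [hgap, hT, hmd, Nat.zero_le (u * u), Nat.zero_le (d * u), Nat.zero_le (c * u), Nat.zero_le (j * u)]

/-- `d + j + 2 = a`: `D − z` on the `T` cell `(k − 1, a, a − 2)`, against the one-triangle target: slack `2`. -/
theorem rowT_del_T (a j d k m' S' T : ℕ) (ha5 : 5 ≤ a) (hs : d + j + 2 = a) (hk : 3 * a + j ≤ k)
    (hmd : m' + d + (a + j) = a * (k - a))
    (hgap : S' + (a - 2) * (k - 1 - 1 - (a - 2)) + 2 * (k - 1 - 2 * a - 1) ≤ m' * (k - 1))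
    (hT : T ≤ d * (k - a - 2)) :
    S' + 2 * T + d + d * d + (a + j) * (k - 1 - (a + j)) + (2 * k - 14 + 2 * j * (a - 3)) ≤ (m' + d) * k := by
  have h1 : 2 ≤ a := by omega
  have h2 : 1 ≤ k := by omega
  have h3 : 1 ≤ k - 1 := by omega
  have h4 : a - 2 ≤ k - 1 - 1 := by omega
  have h5 : 2 * a ≤ k - 1 := by omega
  have h6 : 1 ≤ k - 1 - 2 * a := by omega
  have h7 : a ≤ k := by omega
  have h8 : 2 ≤ k - a := by omega
  have h9 : a + j ≤ k - 1 := by omega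
  have h10 : 14 ≤ 2 * k := by omega
  have h11 : 3 ≤ a := by omega
  zify [h1, h2, h3, h4, h5, h6, h7, h8, h9, h10, h11] at hgap hT hmd ⊢
  nlinarith [hgap, hT, hmd]

/-- `d + j + 1 = a` and `a ≤ j + 4` (so `d ≤ 3`): `D − z` on the `B2` cell `(k − 1, a, a − 1)`, against the
one-triangle target: slack `6 − 2d`. -/
theorem rowT_del_B (a j d k m' S' T : ℕ) (ha5 : 5 ≤ a) (haj : a ≤ j + 4) (hs : d + j + 1 = a)
    (hk : 3 * a + j ≤ k) (hmd : m' + d + (a + j) = a * (k - a))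
    (hgap : S' + (a - 1) * (k - 1 - 1 - (a - 1)) + 2 * (k - 1 - 2 * a - 1) ≤ m' * (k - 1))
    (hT : T ≤ d * (k - a - 2)) :
    S' + 2 * T + d + d * d + (a + j) * (k - 1 - (a + j)) + (2 * k - 14 + 2 * j * (a - 3)) ≤ (m' + d) * k := by
  have hd3 : d ≤ 3 := by omega
  have h1 : 1 ≤ a := by omega
  have h2 : 1 ≤ k := by omega
  have h3 : 1 ≤ k - 1 := by omega
  have h4 : a - 1 ≤ k - 1 - 1 := by omega
  have h5 : 2 * a ≤ k - 1 := by omega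
  have h6 : 1 ≤ k - 1 - 2 * a := by omega
  have h7 : a ≤ k := by omega
  have h8 : 2 ≤ k - a := by omega
  have h9 : a + j ≤ k - 1 := by omega
  have h10 : 14 ≤ 2 * k := by omega
  have h11 : 3 ≤ a := by omega
  zify [h1, h2, h3, h4, h5, h6, h7, h8, h9, h10, h11] at hgap hT hmd ⊢
  nlinarith [hgap, hT, hmd, hd3]

/-- `d + j = a + j′` with `j′ + 5 ≤ a` (the smaller row at its `(j′ + 1)`-broom gap) and `a ≤ j + 4`: slack
`2j′ v + 4v − 2u ≥ 2v` (`a = j′ + 5 + u`, `j = j′ + 1 + v`, `u ≤ v`). -/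
theorem rowT_del_up_broom (a j d j' k m' S' T : ℕ) (haj : a ≤ j + 4) (ha' : j' + 5 ≤ a) (hs : d + j = a + j')
    (hj' : j' + 1 ≤ j) (hk : 3 * a + j ≤ k) (hmd : m' + d + (a + j) = a * (k - a))
    (hgap : S' + (a + j') * (k - 1 - 1 - (a + j')) + (2 * (k - 1 - a - 3) + 2 * j' * (a - 2)) ≤ m' * (k - 1))
    (hT : T ≤ d * (k - a - 2)) :
    S' + 2 * T + d + d * d + (a + j) * (k - 1 - (a + j)) + (2 * k - 14 + 2 * j * (a - 3)) ≤ (m' + d) * k := by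
  obtain ⟨v, rfl⟩ : ∃ v, j = j' + 1 + v := ⟨j - (j' + 1), by omega⟩
  obtain ⟨u, rfl⟩ : ∃ u, a = j' + 5 + u := ⟨a - (j' + 5), by omega⟩
  have huv : u ≤ v := by omega
  have h2 : 1 ≤ k := by omega
  have h3 : 1 ≤ k - 1 := by omega
  have h4 : j' + 5 + u + j' ≤ k - 1 - 1 := by omega
  have h5 : j' + 5 + u ≤ k - 1 := by omega
  have h6 : 3 ≤ k - 1 - (j' + 5 + u) := by omega
  have h7 : 2 ≤ j' + 5 + u := by omega
  have h8 : j' + 5 + u ≤ k := by omega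
  have h9 : 2 ≤ k - (j' + 5 + u) := by omega
  have h10 : j' + 5 + u + (j' + 1 + v) ≤ k - 1 := by omega
  have h11 : 14 ≤ 2 * k := by omega
  have h12 : 3 ≤ j' + 5 + u := by omega
  zify [h2, h3, h4, h5, h6, h7, h8, h9, h10, h11, h12] at hgap hT hmd hs ⊢
  nlinarith [hgap, hT, hmd, hs, huv, Nat.zero_le (j' * v), Nat.zero_le (v * v), Nat.zero_le (u * v)]

/-- `d + j = a + j′` with `a ≤ j′ + 4` (the smaller row at its one-triangle gap, the induction hypothesis):
slack `2uv + 2qv + 6v + 2`. -/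
theorem rowT_del_up_T (a j d j' k m' S' T : ℕ) (ha5 : 5 ≤ a) (haj' : a ≤ j' + 4) (hs : d + j = a + j')
    (hj' : j' + 1 ≤ j) (hk : 3 * a + j ≤ k) (hmd : m' + d + (a + j) = a * (k - a))
    (hgap : S' + (a + j') * (k - 1 - 1 - (a + j')) + (2 * (k - 1) - 14 + 2 * j' * (a - 3)) ≤ m' * (k - 1))
    (hT : T ≤ d * (k - a - 2)) :
    S' + 2 * T + d + d * d + (a + j) * (k - 1 - (a + j)) + (2 * k - 14 + 2 * j * (a - 3)) ≤ (m' + d) * k := by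
  obtain ⟨v, rfl⟩ : ∃ v, j = j' + 1 + v := ⟨j - (j' + 1), by omega⟩
  obtain ⟨q, rfl⟩ : ∃ q, a = q + 5 := ⟨a - 5, by omega⟩
  obtain ⟨u, rfl⟩ : ∃ u, j' = q + 1 + u := ⟨j' - (q + 1), by omega⟩
  have h2 : 1 ≤ k := by omega
  have h3 : 1 ≤ k - 1 := by omega
  have h4 : q + 5 + (q + 1 + u) ≤ k - 1 - 1 := by omega
  have h5 : 14 ≤ 2 * (k - 1) := by omega
  have h6 : 3 ≤ q + 5 := by omega
  have h7 : q + 5 ≤ k := by omega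
  have h8 : 2 ≤ k - (q + 5) := by omega
  have h9 : q + 5 + (q + 1 + u + 1 + v) ≤ k - 1 := by omega
  have h10 : 14 ≤ 2 * k := by omega
  zify [h2, h3, h4, h5, h6, h7, h8, h9, h10] at hgap hT hmd hs ⊢
  nlinarith [hgap, hT, hmd, hs, Nat.zero_le (u * v), Nat.zero_le (q * v), Nat.zero_le (v * v)]

/-- **THE ALL-OFF READ, ARITHMETIC:** `D − z` `a`-bipartite with every neighbour of `z` off the side (`1 ≤ d ≤ a − 1`):
the plain star bound `S′ + (d + j)(k − 2 − (d + j)) ≤ m′ (k − 1)` of `D − z` and `T ≤ d a` give the one-triangle target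
when `a ≤ j + 4` (slack `2 (j + 4 − a)` at `d = 1`). -/
theorem rowT_alloff_arith (a j d k m' S' T : ℕ) (ha5 : 5 ≤ a) (haj : a ≤ j + 4) (hd1 : 1 ≤ d) (hda : d + 1 ≤ a)
    (hk : 3 * a + j ≤ k) (hmd : m' + d + (a + j) = a * (k - a))
    (hS' : S' + (d + j) * (k - 1 - 1 - (d + j)) ≤ m' * (k - 1)) (hT : T ≤ d * a) :
    S' + 2 * T + d + d * d + (a + j) * (k - 1 - (a + j)) + (2 * k - 14 + 2 * j * (a - 3)) ≤ (m' + d) * k := by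
  obtain ⟨q, rfl⟩ : ∃ q, a = q + 5 := ⟨a - 5, by omega⟩
  obtain ⟨p, rfl⟩ : ∃ p, j = q + 1 + p := ⟨j - (q + 1), by omega⟩
  obtain ⟨w, rfl⟩ : ∃ w, d = w + 1 := ⟨d - 1, by omega⟩
  obtain ⟨y, hy⟩ : ∃ y, q + 3 = w + y := ⟨q + 3 - w, by omega⟩
  have h2 : 1 ≤ k := by omega
  have h3 : 1 ≤ k - 1 := by omega
  have h4 : w + 1 + (q + 1 + p) ≤ k - 1 - 1 := by omega
  have h6 : 3 ≤ q + 5 := by omega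
  have h7 : q + 5 ≤ k := by omega
  have h9 : q + 5 + (q + 1 + p) ≤ k - 1 := by omega
  have h10 : 14 ≤ 2 * k := by omega
  zify [h2, h3, h4, h6, h7, h9, h10] at hS' hT hmd hy ⊢
  nlinarith [hS', hT, hmd, hy, Nat.zero_le (w * y), Nat.zero_le (w * q), Nat.zero_le (w * w), Nat.zero_le (w * p),
    Nat.zero_le (q * q), Nat.zero_le (q * p)]

/-- The crude mixed read at `d = 2` (`t = s₀ = 1`): `S′ ≤ closed (k − 1, a, 2 + j)`, the off-side neighbour at
`≤ a`, the in-side one at `≤ k − a − 2`: slack `2` against the one-triangle target (`a ≤ j + 4`). -/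
theorem rowT_mixed_two (a j k m' S' T : ℕ) (ha5 : 5 ≤ a) (haj : a ≤ j + 4) (hk : 3 * a + j ≤ k)
    (hmd : m' + 2 + (a + j) = a * (k - a)) (hS' : S' + (2 + j) * (k - 1 - 1 - (2 + j)) ≤ m' * (k - 1))
    (hT : T ≤ (k - a - 2) + a) :
    S' + 2 * T + 2 + 2 * 2 + (a + j) * (k - 1 - (a + j)) + (2 * k - 14 + 2 * j * (a - 3)) ≤ (m' + 2) * k := by
  have h2 : 1 ≤ k := by omega
  have h3 : 1 ≤ k - 1 := by omega
  have h4 : 2 + j ≤ k - 1 - 1 := by omega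
  have h6 : 3 ≤ a := by omega
  have h7 : a ≤ k := by omega
  have h8 : 2 ≤ k - a := by omega
  have h9 : a + j ≤ k - 1 := by omega
  have h10 : 14 ≤ 2 * k := by omega
  zify [h2, h3, h4, h6, h7, h8, h9, h10] at hS' hT hmd ⊢
  nlinarith [hS', hT, hmd]

end C047

end TriangleCap

end PercRepro
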